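import Mathlib
import Summits.ResolutionOfSingularities.ResolutionOfSingularities.Theorems.RadicialJungCleanModelsCleanProp44SectionPoint
import Literature.AlgebraicGeometry.Resolution.RegularLocalRingsQuotient
import Literature.AlgebraicGeometry.Resolution.CompleteLocalDomainNormalization
import HarnessLib

/-!
# Route `RadicialJung`, crux `CleanModels` (stmt-ResolutionOfSingularities-15917), line `Sketch` rev 35, stub 6 `stub_cleanProp44` (X44c):
# THE CURVE `K = L′_rep ∩ E` IS REGULAR AT A BIRTH — `S/(w)` is a DVR for the new leaf `w = v(c)·T − G^p` on the regular exceptional chart (input of ✓ `descent_at_birth…`)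

Seat decomp-res-hand-2 g21 (structural hand); sequel of ✓ `…SectionPoint` / ✓ `…TransferUnramified` / ✓ `…DescentAtBirth`.  Those take the curve ideal `I` with
`S/I` a discrete valuation ring as data.  Memo 4e §2.5: `K := L′_rep ∩ E` with `L′_rep = V(t′ + g^p)`, `t′ = U − γ^p`, `U = v·t_m`; on the exceptional chart
(`S = 𝒪_{E,c′}`, a REGULAR local ring of dimension `2` with `𝔫_S = (P, T + λ)`) its equation is `w = v(c)·T − G^p`, and `∂w/∂T = v(c) ≠ 0`: `K` is a regular curve
through `c′`.  THIS FILE proves it, def-free, from the tree's regular-local-ring toolkit (Matsumura 14.2/14.3: ✓ `IsRegularLocalRing.quotient_span_singleton`,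
✓ `IsRegularLocalRing.prime_of_not_mem_sq`, ✓ `isDiscreteValuationRing_of_isRegularLocalRing_of_ringKrullDim_eq_one`) and the cotangent independence of
`(P, T + λ)` in the tree's `hli` currency (✓ `Literature/…/RegularParameterFamilies.lean`):

* `charP_of_algebra_polynomial` / `charP_quotient_of_algebra_polynomial` — a non-trivial `κ[u][T]`-algebra (and its proper quotients) has characteristic `p`.
* `exists_newLeaf_congr` — the congruence `v(c)·(T + λ) = w + P·h₁(u) + n₂`, `n₂ ∈ 𝔫_S²` (the computation inside ✓ `maximalIdeal_quotient_eq_span_of_newLeaf`, exported).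
* `newLeaf_mem_maximalIdeal` / `newLeaf_not_mem_sq` — `w ∈ 𝔫_S ∖ 𝔫_S²` (`v(c)` is a unit; `(P, T + λ)` independent modulo `𝔫_S²`).
* `prime_newLeaf` / `isDiscreteValuationRing_quotient_newLeaf` — `w` is prime and `S/(w)` is a DVR (`dim S = 2`).
* `descent_at_birth_of_sectionPoint_regular` — ✓ `descent_at_birth_of_sectionPoint` with `I := (w)`, its primality, the DVR property and the characteristic ALL
  discharged: the inputs at a birth `c′ ∈ Γ″` are now ONLY the localization facts of `𝒪_{E,c′}` at `(P, T + λ)`, regularity of dimension `2` with `hli`, and the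
  surrogate «`δ′ ≥ d′`» read along `K` (`c(T + λ)^μ ∈ (w) + 𝔫_S^{μd′}`).

Honest framing: OURS, elementary; the chart identification (census (S)) remains; nothing here proves X44c, any case of `CleanModels`, or resolution of singularities in
characteristic `p`. [cite: Matsumura1987, Thm. 14.2, Thm. 14.3, Thm. 11.2] [cite: CossartPiltant2008, Prop. 4.4 (proof, p. 11)]
-/

noncomputable section

set_option linter.dupNamespace false -- mandated namespace of this single-conjunct summit

open Polynomial IsLocalRing Literature.AlgebraicGeometry.Resolution

namespace Summit.ResolutionOfSingularities.ResolutionOfSingularities.Theorems.RadicialJung.CleanModels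

section Regular

variable {k : Type*} [Field k] (P lam : k[X]) {S : Type*} [CommRing S] [Algebra (k[X])[X] S]

/-- A non-trivial `κ[u][T]`-algebra has the characteristic of `κ`. [folklore] -/
theorem charP_of_algebra_polynomial (p : ℕ) [CharP k p] [Nontrivial S] : CharP S p :=
  charP_of_injective_ringHom (((algebraMap (k[X])[X] S).comp ((C : k[X] →+* (k[X])[X]).comp C)).injective) p

/-- … and so do its non-trivial quotients. [folklore] -/
theorem charP_quotient_of_algebra_polynomial (p : ℕ) [CharP k p] (I : Ideal S) [Nontrivial (S ⧸ I)] : CharP (S ⧸ I) p :=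
  charP_of_injective_ringHom
    (((Ideal.Quotient.mk I).comp ((algebraMap (k[X])[X] S).comp ((C : k[X] →+* (k[X])[X]).comp C))).injective) p

variable [IsLocalRing S]

/-- **The congruence of the new leaf** (the computation inside ✓ `maximalIdeal_quotient_eq_span_of_newLeaf`, exported): with `𝔫_S ⊇ 𝔫₀S`,
`𝔫_S ∩ κ[u][T] ⊆ 𝔫₀`, fractions, characteristic `p`, and `w = v(c)·T − G^p ∈ 𝔫_S` (the point `c′` lies on the new leaf):
`v(c)·(T + λ) = w + P·h₁(u) + n₂` with `n₂ ∈ 𝔫_S²`. [folklore] -/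
theorem exists_newLeaf_congr (p : ℕ) [hp : Fact p.Prime] [CharP S p] (hP : Prime P)
    (h𝔫 : (Ideal.span ({C P, X + C lam} : Set (k[X])[X])).map (algebraMap (k[X])[X] S) ≤ maximalIdeal S)
    (hcomap : (maximalIdeal S).comap (algebraMap (k[X])[X] S) ≤ Ideal.span ({C P, X + C lam} : Set (k[X])[X]))
    (hsurj : ∀ z : S, ∃ f s : (k[X])[X], s ∉ Ideal.span ({C P, X + C lam} : Set (k[X])[X]) ∧
      z * algebraMap (k[X])[X] S s = algebraMap (k[X])[X] S f)
    (a₀ : k) {G : S} (hw𝔫 : algebraMap (k[X])[X] S (C (C a₀) * X) - G ^ p ∈ maximalIdeal S) :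
    ∃ (h₁ : k[X]) (n₂ : S), n₂ ∈ maximalIdeal S ^ 2 ∧
      algebraMap (k[X])[X] S (C (C a₀)) * algebraMap (k[X])[X] S (X + C lam) =
        (algebraMap (k[X])[X] S (C (C a₀) * X) - G ^ p) + algebraMap (k[X])[X] S (C P) * algebraMap (k[X])[X] S (C h₁) + n₂ := by
  set ι := algebraMap (k[X])[X] S with hι
  have hy𝔫 : ι (X + C lam) ∈ maximalIdeal S := h𝔫 (Ideal.mem_map_of_mem _ (Ideal.subset_span (by simp)))
  obtain ⟨g₀, hg₀⟩ := exists_sub_algebraMap_C_mem_maximalIdeal P lam hP h𝔫 hsurj G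
  have hp1 : p = (p - 2) + 2 := (Nat.sub_add_cancel hp.out.two_le).symm
  have hGp : G ^ p - ι (C (g₀ ^ p)) ∈ maximalIdeal S ^ 2 := by
    rw [map_pow, map_pow, ← sub_pow_char G (ι (C g₀)), hp1, pow_add]
    exact Ideal.mul_mem_left _ _ (Ideal.pow_mem_pow hg₀ 2)
  set h := C a₀ * lam + g₀ ^ p with hh
  have hιh : ι (C h) = (ι (C (C a₀)) * ι (X + C lam) - (ι (C (C a₀) * X) - G ^ p)) - (G ^ p - ι (C (g₀ ^ p))) := by
    simp only [hh, map_add, map_mul]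
    ring
  have hιh𝔫 : ι (C h) ∈ maximalIdeal S := by
    rw [hιh]
    exact Ideal.sub_mem _ (Ideal.sub_mem _ (Ideal.mul_mem_left _ _ hy𝔫) hw𝔫) (Ideal.pow_le_self two_ne_zero hGp)
  have hhP : h ∈ Ideal.span {P} := by
    have h1 : C h ∈ Ideal.span ({C P, X + C lam} : Set (k[X])[X]) := hcomap (by rw [Ideal.mem_comap]; exact hιh𝔫)
    have h2 := eval_mem_span_of_mem_span_pair P lam h1
    rwa [eval_C] at h2
  obtain ⟨h₁, hh₁⟩ := Ideal.mem_span_singleton'.mp hhP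
  refine ⟨h₁, G ^ p - ι (C (g₀ ^ p)), hGp, ?_⟩
  have h3 : ι (C P) * ι (C h₁) = ι (C h) := by rw [← map_mul, ← map_mul, ← hh₁, mul_comm]
  rw [h3, hιh]; ring

/-- **`w ∉ 𝔫_S²`**: with `(P, T + λ)` independent modulo `𝔫_S²` (the tree's `hli` currency for a regular system of parameters of `𝒪_{E,c′}`) and `v(c) ≠ 0`, the new
leaf `w = v(c)·T − G^p` is a regular parameter at `c′`. [cite: Matsumura1987, Thm. 14.2] -/
theorem newLeaf_not_mem_sq (p : ℕ) [Fact p.Prime] [CharP S p] (hP : Prime P)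
    (h𝔫 : (Ideal.span ({C P, X + C lam} : Set (k[X])[X])).map (algebraMap (k[X])[X] S) ≤ maximalIdeal S)
    (hcomap : (maximalIdeal S).comap (algebraMap (k[X])[X] S) ≤ Ideal.span ({C P, X + C lam} : Set (k[X])[X]))
    (hsurj : ∀ z : S, ∃ f s : (k[X])[X], s ∉ Ideal.span ({C P, X + C lam} : Set (k[X])[X]) ∧
      z * algebraMap (k[X])[X] S s = algebraMap (k[X])[X] S f)
    (hli : ∀ α β : S, α * algebraMap (k[X])[X] S (C P) + β * algebraMap (k[X])[X] S (X + C lam) ∈ maximalIdeal S ^ 2 →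
      α ∈ maximalIdeal S ∧ β ∈ maximalIdeal S)
    {a₀ : k} (ha₀ : a₀ ≠ 0) {G : S} (hw𝔫 : algebraMap (k[X])[X] S (C (C a₀) * X) - G ^ p ∈ maximalIdeal S) :
    algebraMap (k[X])[X] S (C (C a₀) * X) - G ^ p ∉ maximalIdeal S ^ 2 := by
  set ι := algebraMap (k[X])[X] S with hι
  intro hw2
  obtain ⟨h₁, n₂, hn₂, hcongr⟩ := exists_newLeaf_congr P lam p hP h𝔫 hcomap hsurj a₀ hw𝔫
  -- `(-ι(C h₁))·x + ι(C(C a₀))·yy = w + n₂ ∈ 𝔫²`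
  have h1 : (-ι (C h₁)) * ι (C P) + ι (C (C a₀)) * ι (X + C lam) ∈ maximalIdeal S ^ 2 := by
    have h2 : (-ι (C h₁)) * ι (C P) + ι (C (C a₀)) * ι (X + C lam) = (ι (C (C a₀) * X) - G ^ p) + n₂ := by
      rw [hcongr]; ring
    rw [h2]
    exact Ideal.add_mem _ hw2 hn₂
  have hunit : IsUnit (ι (C (C a₀))) := (((isUnit_iff_ne_zero.mpr ha₀).map C).map C).map ι
  exact (IsLocalRing.mem_maximalIdeal _).mp (hli _ _ h1).2 hunit

end Regular

section RegularLocal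

variable {k : Type*} [Field k] (P lam : k[X]) {S : Type*} [CommRing S] [Algebra (k[X])[X] S] [IsRegularLocalRing S]

/-- `w` is a prime element of the regular local ring `S = 𝒪_{E,c′}`. [cite: Matsumura1987, Thm. 14.3] -/
theorem prime_newLeaf (p : ℕ) [Fact p.Prime] [CharP S p] (hP : Prime P)
    (h𝔫 : (Ideal.span ({C P, X + C lam} : Set (k[X])[X])).map (algebraMap (k[X])[X] S) ≤ maximalIdeal S)
    (hcomap : (maximalIdeal S).comap (algebraMap (k[X])[X] S) ≤ Ideal.span ({C P, X + C lam} : Set (k[X])[X]))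
    (hsurj : ∀ z : S, ∃ f s : (k[X])[X], s ∉ Ideal.span ({C P, X + C lam} : Set (k[X])[X]) ∧
      z * algebraMap (k[X])[X] S s = algebraMap (k[X])[X] S f)
    (hli : ∀ α β : S, α * algebraMap (k[X])[X] S (C P) + β * algebraMap (k[X])[X] S (X + C lam) ∈ maximalIdeal S ^ 2 →
      α ∈ maximalIdeal S ∧ β ∈ maximalIdeal S)
    {a₀ : k} (ha₀ : a₀ ≠ 0) {G : S} (hw𝔫 : algebraMap (k[X])[X] S (C (C a₀) * X) - G ^ p ∈ maximalIdeal S) :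
    Prime (algebraMap (k[X])[X] S (C (C a₀) * X) - G ^ p) :=
  IsRegularLocalRing.prime_of_not_mem_sq hw𝔫 (newLeaf_not_mem_sq P lam p hP h𝔫 hcomap hsurj hli ha₀ hw𝔫)

/-- **`K` is a regular curve at `c′`: `S/(w)` is a discrete valuation ring** (`S = 𝒪_{E,c′}` regular local of dimension `2`). [cite: Matsumura1987, Thm. 14.2, Thm. 11.2] -/
theorem isDiscreteValuationRing_quotient_newLeaf (p : ℕ) [Fact p.Prime] [CharP S p] (hP : Prime P)
    (h𝔫 : (Ideal.span ({C P, X + C lam} : Set (k[X])[X])).map (algebraMap (k[X])[X] S) ≤ maximalIdeal S)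
    (hcomap : (maximalIdeal S).comap (algebraMap (k[X])[X] S) ≤ Ideal.span ({C P, X + C lam} : Set (k[X])[X]))
    (hsurj : ∀ z : S, ∃ f s : (k[X])[X], s ∉ Ideal.span ({C P, X + C lam} : Set (k[X])[X]) ∧
      z * algebraMap (k[X])[X] S s = algebraMap (k[X])[X] S f)
    (hli : ∀ α β : S, α * algebraMap (k[X])[X] S (C P) + β * algebraMap (k[X])[X] S (X + C lam) ∈ maximalIdeal S ^ 2 →
      α ∈ maximalIdeal S ∧ β ∈ maximalIdeal S)
    (hdim : ringKrullDim S = 2)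
    {a₀ : k} (ha₀ : a₀ ≠ 0) {G : S} (hw𝔫 : algebraMap (k[X])[X] S (C (C a₀) * X) - G ^ p ∈ maximalIdeal S) :
    ∃ (_ : (Ideal.span {algebraMap (k[X])[X] S (C (C a₀) * X) - G ^ p}).IsPrime),
      IsDiscreteValuationRing (S ⧸ Ideal.span {algebraMap (k[X])[X] S (C (C a₀) * X) - G ^ p}) := by
  have hw2 := newLeaf_not_mem_sq P lam p hP h𝔫 hcomap hsurj hli ha₀ hw𝔫
  have hprime := IsRegularLocalRing.prime_of_not_mem_sq hw𝔫 hw2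
  haveI hI : (Ideal.span {algebraMap (k[X])[X] S (C (C a₀) * X) - G ^ p}).IsPrime :=
    (Ideal.span_singleton_prime hprime.ne_zero).mpr hprime
  obtain ⟨hreg, hdim'⟩ := IsRegularLocalRing.quotient_span_singleton hw𝔫 hw2
  haveI := hreg
  refine ⟨hI, isDiscreteValuationRing_of_isRegularLocalRing_of_ringKrullDim_eq_one _ ?_⟩
  obtain ⟨n, hn⟩ := exists_nat_cast_eq_ringKrullDim (R := S ⧸ Ideal.span {algebraMap (k[X])[X] S (C (C a₀) * X) - G ^ p})
  rw [hn, hdim] at hdim'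
  rw [hn]
  have h1 : ((n + 1 : ℕ) : WithBot ℕ∞) = ((2 : ℕ) : WithBot ℕ∞) := by exact_mod_cast hdim'
  have h2 : n + 1 = 2 := by exact_mod_cast h1
  have h3 : n = 1 := by omega
  subst h3
  rfl

/-- **THE DESCENT AT ONE BIRTH with `I := (w)` and all its side conditions discharged**: on the regular two-dimensional local ring `S = 𝒪_{E,c′}` presented at
`(P, T + λ)` (localization facts + `hli`), with the new leaf `w = v(c)·T − G^p ∈ 𝔫_S` (`v(c) ≠ 0`) and the surrogate «`δ′ ≥ d′`» read along `K = V(w)`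
(`c(T + λ)^μ ∈ (w) + 𝔫_S^{μd′}`): some polynomial `g` has `(−v(c))λ·1^p + (−g)^p ∈ (P)^{d′}`. [cite: CossartPiltant2008, Prop. 4.4 (proof, p. 11)] -/
theorem descent_at_birth_of_sectionPoint_regular (p : ℕ) [Fact p.Prime] [CharP k p] (hP : Prime P)
    (h𝔫eq : maximalIdeal S = (Ideal.span ({C P, X + C lam} : Set (k[X])[X])).map (algebraMap (k[X])[X] S))
    (hcomap : (maximalIdeal S).comap (algebraMap (k[X])[X] S) ≤ Ideal.span ({C P, X + C lam} : Set (k[X])[X]))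
    (hsurj : ∀ z : S, ∃ f s : (k[X])[X], s ∉ Ideal.span ({C P, X + C lam} : Set (k[X])[X]) ∧
      z * algebraMap (k[X])[X] S s = algebraMap (k[X])[X] S f)
    (hli : ∀ α β : S, α * algebraMap (k[X])[X] S (C P) + β * algebraMap (k[X])[X] S (X + C lam) ∈ maximalIdeal S ^ 2 →
      α ∈ maximalIdeal S ∧ β ∈ maximalIdeal S)
    (hdim : ringKrullDim S = 2) {c : k} (hc : c ≠ 0) {a₀ : k} (ha₀ : a₀ ≠ 0) {μ d' : ℕ} (hμ : 0 < μ) {G : S}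
    (hw𝔫 : algebraMap (k[X])[X] S (C (C a₀) * X) - G ^ p ∈ maximalIdeal S)
    (hf : algebraMap (k[X])[X] S (C (C c) * (X + C lam) ^ μ) ∈
      Ideal.span {algebraMap (k[X])[X] S (C (C a₀) * X) - G ^ p} ⊔ maximalIdeal S ^ (μ * d')) :
    ∃ g : k[X], C (-a₀) * lam * 1 ^ p + (-g) ^ p ∈ Ideal.span {P} ^ d' := by
  haveI : CharP S p := charP_of_algebra_polynomial (k := k) p
  obtain ⟨hI, hdvr⟩ := isDiscreteValuationRing_quotient_newLeaf P lam p hP h𝔫eq.symm.le hcomap hsurj hli hdim ha₀ hw𝔫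
  haveI := hI
  haveI := hdvr
  haveI : CharP (S ⧸ Ideal.span {algebraMap (k[X])[X] S (C (C a₀) * X) - G ^ p}) p :=
    charP_quotient_of_algebra_polynomial (k := k) p _
  exact descent_at_birth_of_sectionPoint P lam p hP h𝔫eq hcomap hsurj _ ((Ideal.span_singleton_le_iff_mem _).mpr hw𝔫) hc ha₀ hμ
    (Ideal.mem_span_singleton_self _) hf

end RegularLocal

end Summit.ResolutionOfSingularities.ResolutionOfSingularities.Theorems.RadicialJung.CleanModels

end
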